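import Summits.QuantumFields.BalabanUV.Beta.GAN24.AliasStripSymbols

/-!
# `BalabanUV.Beta.GAN24.AliasStripSymbolsShift` — binder row G-an2-4 / (CONV-C), road P1-fibre, p1 row **P1-L10** `FibreStrip`, sub-row **F2** of the L10 cut
# «(M4) scaled alias-space Neumann, two anchors» (`HOME/b2b-balaban-gan24-formalise-leaf-16/L10-CUT-M4.md`), PART 2: SHIFTS `k ↦ k + h` of the fine momentum by a
# COMPLEX vector `h` — the symbol-level Lipschitz input of F4 (inner anchor `p = 0`, `h = p/N`) and F6 (outer anchor `Re p`, `h = iηa/N`)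

NOT IN PRINT; OUR PROOF ATTEMPT.  HONEST FRAMING (cell contract, verbatim): «discharging `BetaPertH` makes Bałaban's UV stability UNCONDITIONAL — a real
constructive-QFT result; it is NOT the continuum limit and NOT the Clay problem.»  HONEST DEPENDENCY (verbatim): «continuum YM on T⁴ ⇐ BetaPertH ∧ nine spine
estimates (0/9 proved); BetaPertH ⇐ (D1) ∧ (D4) ∧ CAP+tail; G-an2-4 gates asym, D1 and NE2/3/4.»  [folklore] complex trigonometry; no cited fact, no `def … : Prop`,
no wall binder; constants are the explicit numerals `3 ≥ e`, `6 ≥ 2e`, `11 ≥ 4e`, `18 = 6·3`.  Discharges NOTHING of the K-slot `GAN24.CombesThomas.ConvCK 3 Lc`; NOT `BetaPertH`,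
NOT continuum, NOT Clay.

## What is proved (generic `D`; `k h : Fin D → ℂ`, `u_κ = Re k_κ`, `v_κ = Im k_κ`)
§1 exact difference identities: `e^{i(w+h)} − e^{iw} = e^{iw}(e^{ih} − 1)`; `dhat (k + h) κ − dhat k κ = e^{ik_κ}(e^{ih_κ} − 1)`; `dflat (k + h) κ − dflat k κ =
   e^{−ik_κ}(e^{−ih_κ} − 1)`; and the RELATIVE identity for the Laplacian symbol
   `lapSym (k + h) − lapSym k = Σ_κ (1 − e^{ih_κ})·(dhat k κ − dflat (k + h) κ)` — the bracket is FIRST ORDER in the momentum, so the shift of `|∂̂|²` is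
   `O(|h|·(|k| + |h|))`, not `O(|h|)`: this is what makes the block perturbation RELATIVE (`≤ C|h|/|q_m|` against `L_m ≥ (2/π²)|q_m|²/N²`, part 1).
§2 structural norm bounds: `‖dhat (k+h) κ − dhat k κ‖ ≤ e^{|v_κ|}‖e^{ih_κ} − 1‖`, the `dflat` twin, `‖lapSym (k+h) − lapSym k‖ ≤ Σ_κ ‖e^{ih_κ} − 1‖(‖dhat k κ‖ + ‖dflat (k+h) κ‖)`,
   and the off-diagonal products `‖dhat' κ dflat' l − dhat κ dflat l‖ ≤ ‖Δdhat κ‖‖dflat' l‖ + ‖dhat κ‖‖Δdflat l‖`.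
§3 packaged numeric forms under `|v_κ| ≤ δ`, `‖h_κ‖ ≤ ε` (all `κ`), `δ + ε ≤ 1`: `‖Δdhat κ‖, ‖Δdflat κ‖ ≤ 6ε`; `‖ΔlapSym‖ ≤ 11 ε Σ_κ (|u_κ| + δ + ε)`;
   `‖Δ(dhat κ dflat l)‖ ≤ 18 ε (|u_κ| + |u_l| + 2δ + 2ε)`; and the SCALED form (`u = q/N`, `δ = ρ/N`, `ε = ε′/N`): `‖ΔlapSym‖ ≤ 11 ε′ Σ_κ (|q_κ| + ρ + ε′)/N²`.
Companions: part 1 `GAN24/AliasStripSymbols` (moduli, two-sided `lapSym` bounds), part 3 `GAN24/AliasStripSymbolsSum` (geometric sums).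

Unit `b2b-balaban-gan24-formalise-leaf-19` (G-an2-4 formalisation swarm, leaf prover 19), 2026-08-20.  Value = kernel bookkeeping toward the K-slot route P1, NOT summit progress.
-/

noncomputable section

open Complex Finset
open scoped BigOperators Real

namespace Summit.QuantumFields.BalabanUV.Beta.GAN24.AliasStripSymbolsShift

open FibreSymbols (dhat dflat lapSym)
open AliasStripSymbols (norm_cexp_I_mul_le norm_cexp_neg_I_mul_le norm_cexp_I_mul_sub_one_le' norm_cexp_I_mul_sub_one_le_two_mul
  norm_dhat_le_of_le)

variable {D : ℕ}

/-! ## §1 Exact difference identities -/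

/-- [folklore] `e^{i(w+h)} − e^{iw} = e^{iw}·(e^{ih} − 1)`. -/
theorem cexp_I_mul_add_sub (w h : ℂ) : cexp (I * (w + h)) - cexp (I * w) = cexp (I * w) * (cexp (I * h) - 1) := by
  rw [mul_add, Complex.exp_add]; ring

/-- [folklore] `e^{−i(w+h)} − e^{−iw} = e^{−iw}·(e^{−ih} − 1)`. -/
theorem cexp_neg_I_mul_add_sub (w h : ℂ) :
    cexp (-(I * (w + h))) - cexp (-(I * w)) = cexp (-(I * w)) * (cexp (-(I * h)) - 1) := by
  rw [mul_add, neg_add, Complex.exp_add]; ring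

/-- [folklore] **SHIFT OF THE FORWARD SYMBOL**: `dhat (k + h) κ − dhat k κ = e^{ik_κ}(e^{ih_κ} − 1)`. -/
theorem dhat_add_sub (k h : Fin D → ℂ) (κ : Fin D) : dhat (k + h) κ - dhat k κ = cexp (I * k κ) * (cexp (I * h κ) - 1) := by
  unfold FibreSymbols.dhat
  rw [Pi.add_apply, ← cexp_I_mul_add_sub]; ring

/-- [folklore] **SHIFT OF THE REFLECTED SYMBOL**: `dflat (k + h) κ − dflat k κ = e^{−ik_κ}(e^{−ih_κ} − 1)`. -/
theorem dflat_add_sub (k h : Fin D → ℂ) (κ : Fin D) :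
    dflat (k + h) κ - dflat k κ = cexp (-(I * k κ)) * (cexp (-(I * h κ)) - 1) := by
  unfold FibreSymbols.dflat
  rw [Pi.add_apply, ← cexp_neg_I_mul_add_sub]; ring

/-- [folklore] One coordinate of the Laplacian symbol, shifted: `dhat' dflat' − dhat dflat = (1 − e^{ih})(dhat k − dflat (k+h))` (all at coordinate `κ`). -/
theorem dhat_mul_dflat_add_sub (k h : Fin D → ℂ) (κ : Fin D) :
    dhat (k + h) κ * dflat (k + h) κ - dhat k κ * dflat k κ = (1 - cexp (I * h κ)) * (dhat k κ - dflat (k + h) κ) := by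
  unfold FibreSymbols.dhat FibreSymbols.dflat
  rw [Pi.add_apply]
  set a := cexp (I * k κ) with ha
  set b := cexp (I * h κ) with hb
  have ha0 : a ≠ 0 := Complex.exp_ne_zero _
  have hb0 : b ≠ 0 := Complex.exp_ne_zero _
  have e1 : cexp (I * (k κ + h κ)) = a * b := by rw [ha, hb, ← Complex.exp_add]; ring_nf
  have e2 : cexp (-(I * (k κ + h κ))) = a⁻¹ * b⁻¹ := by rw [Complex.exp_neg, e1, mul_inv]
  have e3 : cexp (-(I * k κ)) = a⁻¹ := by rw [Complex.exp_neg]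
  rw [e1, e2, e3]
  field_simp
  ring

/-- [folklore] **THE RELATIVE SHIFT IDENTITY FOR `|∂̂|²`**: `lapSym (k + h) − lapSym k = Σ_κ (1 − e^{ih_κ})·(dhat k κ − dflat (k + h) κ)`. -/
theorem lapSym_add_sub (k h : Fin D → ℂ) :
    lapSym (k + h) - lapSym k = ∑ κ, (1 - cexp (I * h κ)) * (dhat k κ - dflat (k + h) κ) := by
  unfold FibreSymbols.lapSym
  rw [← Finset.sum_sub_distrib]
  exact Finset.sum_congr rfl fun κ _ => dhat_mul_dflat_add_sub k h κ

/-! ## §2 Structural norm bounds -/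

/-- [folklore] `‖dhat (k+h) κ − dhat k κ‖ ≤ e^{|v_κ|}·‖e^{ih_κ} − 1‖`. -/
theorem norm_dhat_add_sub_le (k h : Fin D → ℂ) (κ : Fin D) :
    ‖dhat (k + h) κ - dhat k κ‖ ≤ Real.exp |(k κ).im| * ‖cexp (I * h κ) - 1‖ := by
  rw [dhat_add_sub, norm_mul]
  exact mul_le_mul_of_nonneg_right (norm_cexp_I_mul_le _) (norm_nonneg _)

/-- [folklore] `‖dflat (k+h) κ − dflat k κ‖ ≤ e^{|v_κ|}·‖e^{−ih_κ} − 1‖`. -/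
theorem norm_dflat_add_sub_le (k h : Fin D → ℂ) (κ : Fin D) :
    ‖dflat (k + h) κ - dflat k κ‖ ≤ Real.exp |(k κ).im| * ‖cexp (-(I * h κ)) - 1‖ := by
  rw [dflat_add_sub, norm_mul]
  exact mul_le_mul_of_nonneg_right (norm_cexp_neg_I_mul_le _) (norm_nonneg _)

/-- [folklore] First-order forms: `‖Δdhat κ‖, ‖Δdflat κ‖ ≤ e^{|v_κ|}·(|Re h_κ| + |Im h_κ|)·e^{|Im h_κ|}`. -/
theorem norm_dhat_add_sub_le' (k h : Fin D → ℂ) (κ : Fin D) :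
    ‖dhat (k + h) κ - dhat k κ‖ ≤ Real.exp |(k κ).im| * ((|(h κ).re| + |(h κ).im|) * Real.exp |(h κ).im|) ∧
    ‖dflat (k + h) κ - dflat k κ‖ ≤ Real.exp |(k κ).im| * ((|(h κ).re| + |(h κ).im|) * Real.exp |(h κ).im|) := by
  refine ⟨(norm_dhat_add_sub_le k h κ).trans (mul_le_mul_of_nonneg_left (norm_cexp_I_mul_sub_one_le' _) (by positivity)),
    (norm_dflat_add_sub_le k h κ).trans (mul_le_mul_of_nonneg_left ?_ (by positivity))⟩
  have h1 := norm_cexp_I_mul_sub_one_le' (-h κ)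
  rw [Complex.neg_re, Complex.neg_im, abs_neg, abs_neg, mul_neg] at h1
  exact h1

/-- [folklore] Small-shift forms: `‖h_κ‖ ≤ 1 ⇒ ‖Δdhat κ‖, ‖Δdflat κ‖ ≤ e^{|v_κ|}·2‖h_κ‖`. -/
theorem norm_dhat_add_sub_le_of_norm_le (k h : Fin D → ℂ) (κ : Fin D) (hh : ‖h κ‖ ≤ 1) :
    ‖dhat (k + h) κ - dhat k κ‖ ≤ Real.exp |(k κ).im| * (2 * ‖h κ‖) ∧
    ‖dflat (k + h) κ - dflat k κ‖ ≤ Real.exp |(k κ).im| * (2 * ‖h κ‖) := by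
  refine ⟨(norm_dhat_add_sub_le k h κ).trans (mul_le_mul_of_nonneg_left (norm_cexp_I_mul_sub_one_le_two_mul hh) (by positivity)),
    (norm_dflat_add_sub_le k h κ).trans (mul_le_mul_of_nonneg_left ?_ (by positivity))⟩
  have h1 := norm_cexp_I_mul_sub_one_le_two_mul (w := -h κ) (by rwa [norm_neg])
  rwa [mul_neg, norm_neg] at h1

/-- [folklore] **STRUCTURAL BOUND FOR THE LAPLACIAN SHIFT**: `‖lapSym (k+h) − lapSym k‖ ≤ Σ_κ ‖e^{ih_κ} − 1‖·(‖dhat k κ‖ + ‖dflat (k+h) κ‖)`. -/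
theorem norm_lapSym_add_sub_le (k h : Fin D → ℂ) :
    ‖lapSym (k + h) - lapSym k‖ ≤ ∑ κ, ‖cexp (I * h κ) - 1‖ * (‖dhat k κ‖ + ‖dflat (k + h) κ‖) := by
  rw [lapSym_add_sub]
  refine (norm_sum_le _ _).trans (Finset.sum_le_sum fun κ _ => ?_)
  rw [norm_mul]
  have h1 : ‖1 - cexp (I * h κ)‖ = ‖cexp (I * h κ) - 1‖ := by rw [← norm_neg, neg_sub]
  rw [h1]
  exact mul_le_mul_of_nonneg_left (norm_sub_le _ _) (norm_nonneg _)

/-- [folklore] **OFF-DIAGONAL PRODUCTS** (entries `∂̂_κ ∂̂♭_l` of the block `T(k)`): `‖dhat' κ·dflat' l − dhat κ·dflat l‖ ≤ ‖Δdhat κ‖·‖dflat' l‖ + ‖dhat κ‖·‖Δdflat l‖`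
(primes = at `k + h`). -/
theorem norm_dhat_mul_dflat_add_sub_le (k h : Fin D → ℂ) (κ l : Fin D) :
    ‖dhat (k + h) κ * dflat (k + h) l - dhat k κ * dflat k l‖
      ≤ ‖dhat (k + h) κ - dhat k κ‖ * ‖dflat (k + h) l‖ + ‖dhat k κ‖ * ‖dflat (k + h) l - dflat k l‖ := by
  have e : dhat (k + h) κ * dflat (k + h) l - dhat k κ * dflat k l
      = (dhat (k + h) κ - dhat k κ) * dflat (k + h) l + dhat k κ * (dflat (k + h) l - dflat k l) := by ring
  rw [e]
  exact (norm_add_le _ _).trans (le_of_eq (by rw [norm_mul, norm_mul]))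

/-! ## §3 Packaged numeric forms on the strip: `|v_κ| ≤ δ`, `‖h_κ‖ ≤ ε`, `δ + ε ≤ 1` -/

section Packaged

variable {k h : Fin D → ℂ} {δ ε : ℝ}

/-- [folklore] Bookkeeping: from `|v_κ| ≤ δ`, `‖h_κ‖ ≤ ε`, `δ + ε ≤ 1` at ONE coordinate: `0 ≤ ε`, `ε ≤ 1`, `|Re h_κ|, |Im h_κ| ≤ ε`, `|Im (k+h)_κ| ≤ δ + ε`,
`e^{|v_κ|} ≤ e ≤ 3`, `e^{δ+ε} ≤ 3`. -/
theorem strip_bookkeeping {κ : Fin D} (hδ : |(k κ).im| ≤ δ) (hε : ‖h κ‖ ≤ ε) (hδε : δ + ε ≤ 1) :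
    0 ≤ ε ∧ ε ≤ 1 ∧ |(h κ).re| ≤ ε ∧ |(h κ).im| ≤ ε ∧ |((k + h) κ).im| ≤ δ + ε ∧ Real.exp |(k κ).im| ≤ 3 ∧ Real.exp (δ + ε) ≤ 3 := by
  have hε0 : 0 ≤ ε := (norm_nonneg _).trans hε
  have hδ0 : 0 ≤ δ := (abs_nonneg _).trans hδ
  have hre : |(h κ).re| ≤ ε := (Complex.abs_re_le_norm _).trans hε
  have him : |(h κ).im| ≤ ε := (Complex.abs_im_le_norm _).trans hε
  have exp_one_le_three : Real.exp 1 ≤ 3 := by have := Real.exp_one_lt_d9; linarith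
  refine ⟨hε0, by linarith, hre, him, ?_, ?_, ?_⟩
  · rw [Pi.add_apply, Complex.add_im]
    exact (abs_add_le _ _).trans (add_le_add hδ him)
  · exact (Real.exp_le_exp.2 (hδ.trans (by linarith))).trans exp_one_le_three
  · exact (Real.exp_le_exp.2 hδε).trans exp_one_le_three

/-- [folklore] **`‖Δdhat κ‖, ‖Δdflat κ‖ ≤ 6ε`** on the strip. -/
theorem norm_dhat_add_sub_le_num {κ : Fin D} (hδ : |(k κ).im| ≤ δ) (hε : ‖h κ‖ ≤ ε) (hδε : δ + ε ≤ 1) :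
    ‖dhat (k + h) κ - dhat k κ‖ ≤ 6 * ε ∧ ‖dflat (k + h) κ - dflat k κ‖ ≤ 6 * ε := by
  obtain ⟨hε0, hε1, -, -, -, hek, -⟩ := strip_bookkeeping hδ hε hδε
  obtain ⟨h1, h2⟩ := norm_dhat_add_sub_le_of_norm_le k h κ (hε.trans hε1)
  have hm : Real.exp |(k κ).im| * (2 * ‖h κ‖) ≤ 6 * ε := by nlinarith [norm_nonneg (h κ), Real.exp_pos |(k κ).im|]
  exact ⟨h1.trans hm, h2.trans hm⟩

/-- [folklore] Sizes of the symbols themselves on the strip: `‖dhat k κ‖, ‖dflat k κ‖ ≤ 3(|u_κ| + δ)` and, at the shifted momentum,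
`‖dhat (k+h) κ‖, ‖dflat (k+h) κ‖ ≤ 3(|u_κ| + δ + 2ε)`. -/
theorem norm_dhat_le_num {κ : Fin D} (hδ : |(k κ).im| ≤ δ) (hε : ‖h κ‖ ≤ ε) (hδε : δ + ε ≤ 1) :
    (‖dhat k κ‖ ≤ 3 * (|(k κ).re| + δ) ∧ ‖dflat k κ‖ ≤ 3 * (|(k κ).re| + δ)) ∧
    (‖dhat (k + h) κ‖ ≤ 3 * (|(k κ).re| + δ + 2 * ε) ∧ ‖dflat (k + h) κ‖ ≤ 3 * (|(k κ).re| + δ + 2 * ε)) := by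
  obtain ⟨hε0, -, hre, -, himk, hek, hek'⟩ := strip_bookkeeping hδ hε hδε
  have hδ0 : 0 ≤ δ := (abs_nonneg _).trans hδ
  obtain ⟨a1, a2⟩ := norm_dhat_le_of_le (k := k) (κ := κ) le_rfl hδ
  have hre' : |((k + h) κ).re| ≤ |(k κ).re| + ε := by
    rw [Pi.add_apply, Complex.add_re]; exact (abs_add_le _ _).trans (add_le_add le_rfl hre)
  obtain ⟨b1, b2⟩ := norm_dhat_le_of_le (k := k + h) (κ := κ) hre' himk
  have hexpδ : Real.exp δ ≤ 3 := (Real.exp_le_exp.2 (by linarith : δ ≤ δ + ε)).trans hek'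
  have m1 : (|(k κ).re| + δ) * Real.exp δ ≤ 3 * (|(k κ).re| + δ) := by nlinarith [abs_nonneg (k κ).re, Real.exp_pos δ]
  have m2 : (|(k κ).re| + ε + (δ + ε)) * Real.exp (δ + ε) ≤ 3 * (|(k κ).re| + δ + 2 * ε) := by
    nlinarith [abs_nonneg (k κ).re, Real.exp_pos (δ + ε)]
  exact ⟨⟨a1.trans m1, a2.trans m1⟩, ⟨b1.trans m2, b2.trans m2⟩⟩

/-- [folklore] **`‖lapSym (k+h) − lapSym k‖ ≤ 11 ε Σ_κ (|u_κ| + δ + ε)`** on the strip (`11 ≥ 4e`): the RELATIVE Laplacian shift. -/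
theorem norm_lapSym_add_sub_le_num (hδ : ∀ κ, |(k κ).im| ≤ δ) (hε : ∀ κ, ‖h κ‖ ≤ ε) (hδε : δ + ε ≤ 1) :
    ‖lapSym (k + h) - lapSym k‖ ≤ 11 * ε * ∑ κ, (|(k κ).re| + δ + ε) := by
  refine (norm_lapSym_add_sub_le k h).trans ?_
  rw [Finset.mul_sum]
  refine Finset.sum_le_sum fun κ _ => ?_
  obtain ⟨hε0, hε1, hre, him, himk, hek, hek'⟩ := strip_bookkeeping (hδ κ) (hε κ) hδε
  have hδ0 : 0 ≤ δ := (abs_nonneg _).trans (hδ κ)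
  have he : Real.exp 1 ≤ 2.7182818286 := Real.exp_one_lt_d9.le
  -- the three factors
  have f1 : ‖cexp (I * h κ) - 1‖ ≤ 2 * ε := (norm_cexp_I_mul_sub_one_le_two_mul ((hε κ).trans hε1)).trans (by linarith [hε κ])
  have f2 : ‖dhat k κ‖ ≤ (|(k κ).re| + δ) * Real.exp 1 :=
    (norm_dhat_le_of_le (k := k) (κ := κ) le_rfl (hδ κ)).1.trans
      (mul_le_mul_of_nonneg_left (Real.exp_le_exp.2 (by linarith)) (by positivity))
  have hre' : |((k + h) κ).re| ≤ |(k κ).re| + ε := by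
    rw [Pi.add_apply, Complex.add_re]; exact (abs_add_le _ _).trans (add_le_add le_rfl hre)
  have f3 : ‖dflat (k + h) κ‖ ≤ (|(k κ).re| + ε + (δ + ε)) * Real.exp 1 :=
    (norm_dhat_le_of_le (k := k + h) (κ := κ) hre' himk).2.trans
      (mul_le_mul_of_nonneg_left (Real.exp_le_exp.2 hδε) (by positivity))
  have hsum : ‖dhat k κ‖ + ‖dflat (k + h) κ‖ ≤ 2 * (|(k κ).re| + δ + ε) * Real.exp 1 := by nlinarith [Real.exp_pos (1 : ℝ)]
  have hA : 0 ≤ |(k κ).re| + δ + ε := by linarith [abs_nonneg (k κ).re]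
  have key : ε * (|(k κ).re| + δ + ε) * Real.exp 1 ≤ ε * (|(k κ).re| + δ + ε) * 2.7182818286 :=
    mul_le_mul_of_nonneg_left he (mul_nonneg hε0 hA)
  calc ‖cexp (I * h κ) - 1‖ * (‖dhat k κ‖ + ‖dflat (k + h) κ‖)
      ≤ (2 * ε) * (2 * (|(k κ).re| + δ + ε) * Real.exp 1) := mul_le_mul f1 hsum (by positivity) (by positivity)
    _ = 4 * (ε * (|(k κ).re| + δ + ε) * Real.exp 1) := by ring
    _ ≤ 4 * (ε * (|(k κ).re| + δ + ε) * 2.7182818286) := by linarith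
    _ ≤ 11 * ε * (|(k κ).re| + δ + ε) := by nlinarith [mul_nonneg hε0 hA]

/-- [folklore] **OFF-DIAGONAL PRODUCT SHIFT** `‖dhat' κ dflat' l − dhat κ dflat l‖ ≤ 18 ε (|u_κ| + |u_l| + 2δ + 2ε)` on the strip (the constant is what the two
bricks `‖Δ·‖ ≤ 6ε` and `‖·‖ ≤ 3(…)` give). -/
theorem norm_dhat_mul_dflat_add_sub_le_num (hδ : ∀ κ, |(k κ).im| ≤ δ) (hε : ∀ κ, ‖h κ‖ ≤ ε) (hδε : δ + ε ≤ 1) (κ l : Fin D) :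
    ‖dhat (k + h) κ * dflat (k + h) l - dhat k κ * dflat k l‖ ≤ 18 * ε * (|(k κ).re| + |(k l).re| + 2 * δ + 2 * ε) := by
  refine (norm_dhat_mul_dflat_add_sub_le k h κ l).trans ?_
  obtain ⟨d1, -⟩ := norm_dhat_add_sub_le_num (hδ κ) (hε κ) hδε
  obtain ⟨-, d2⟩ := norm_dhat_add_sub_le_num (hδ l) (hε l) hδε
  obtain ⟨⟨a1, -⟩, -⟩ := norm_dhat_le_num (hδ κ) (hε κ) hδε
  obtain ⟨-, ⟨-, b2⟩⟩ := norm_dhat_le_num (hδ l) (hε l) hδε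
  have hε0 : 0 ≤ ε := (norm_nonneg _).trans (hε κ)
  have hδ0 : 0 ≤ δ := (abs_nonneg _).trans (hδ κ)
  calc ‖dhat (k + h) κ - dhat k κ‖ * ‖dflat (k + h) l‖ + ‖dhat k κ‖ * ‖dflat (k + h) l - dflat k l‖
      ≤ (6 * ε) * (3 * (|(k l).re| + δ + 2 * ε)) + (3 * (|(k κ).re| + δ)) * (6 * ε) :=
        add_le_add (mul_le_mul d1 b2 (norm_nonneg _) (by positivity)) (mul_le_mul a1 d2 (norm_nonneg _) (by positivity))
    _ ≤ 18 * ε * (|(k κ).re| + |(k l).re| + 2 * δ + 2 * ε) := by nlinarith [abs_nonneg (k κ).re, abs_nonneg (k l).re]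

end Packaged

/-! ### §3b  The SCALED form (`u = q/N`, `δ = ρ/N`, `ε = ε′/N`) -/

/-- [folklore] **SCALED RELATIVE LAPLACIAN SHIFT**: for `0 < N`, `Re k_κ = q_κ/N`, `|Im k_κ| ≤ ρ/N`, `‖h_κ‖ ≤ ε′/N` (all `κ`) and `ρ + ε′ ≤ N`:
`‖lapSym (k + h) − lapSym k‖ ≤ 11·ε′·Σ_κ (|q_κ| + ρ + ε′)/N²` — to be read against part 1's `(2/π²)|q|²/N² ≤ re lapSym k` (relative size `O(ε′/|q|)`). -/
theorem norm_lapSym_add_sub_le_scaled {N ρ ε' : ℝ} (hN : 0 < N) (q : Fin D → ℝ) (k h : Fin D → ℂ)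
    (hre : ∀ κ, (k κ).re = q κ / N) (him : ∀ κ, |(k κ).im| ≤ ρ / N) (hh : ∀ κ, ‖h κ‖ ≤ ε' / N) (hρε : ρ + ε' ≤ N) :
    ‖lapSym (k + h) - lapSym k‖ ≤ 11 * ε' * (∑ κ, (|q κ| + ρ + ε')) / N ^ 2 := by
  have hδε : ρ / N + ε' / N ≤ 1 := by rw [← add_div, div_le_one hN]; exact hρε
  have h1 := norm_lapSym_add_sub_le_num (k := k) (h := h) him hh hδε
  have e : ∀ κ, |(k κ).re| + ρ / N + ε' / N = (|q κ| + ρ + ε') / N := fun κ => by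
    rw [hre κ, abs_div, abs_of_pos hN]; ring
  simp only [e] at h1
  rw [← Finset.sum_div] at h1
  exact h1.trans (le_of_eq (by ring))

end Summit.QuantumFields.BalabanUV.Beta.GAN24.AliasStripSymbolsShift

end
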